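import Summits.BirchSwinnertonDyer.Rank1Residual.Additive.KatoDescentRankOneCountReadingAdditiveOfFacts
import Summits.BirchSwinnertonDyer.BirchSwinnertonDyer.Theorems.KatoDescentPotSupersingularExactFineControl
import Summits.BirchSwinnertonDyer.BirchSwinnertonDyer.Theorems.KatoDescentPotSupersingularTowerTorsionVanishing
import Literature.NumberTheory.EllipticCurves.IwasawaEulerCharDualityProofs
import HarnessLib

set_option autoImplicit false

/-!
# COUNT-X₀ IS A THEOREM ON THE TAME ROWS (`W(ℚ_p)[p] = 0`) modulo the display H2X′ (Kato's `𝐇²/X₀ ↪ 𝐇²_loc ≅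
# (W(ℚ_{p,∞})[p^∞])^∨`); hence the v5-recut stub 3 on the tame all-additive / CM rows closes modulo
# {GZK, lev, `thm12_4`, H2X′} + PR-INV ONLY (seat `bsd-cm-prr-ty1` g13, cell `bsd-cm`; theorems only: no definition,
# no named fact, no instance, no `sorry`)

Part 37 of the seat's kernel cut of stub 3 `stub_rankOneCountReadingKato` of the Kato–Perrin-Riou skeletons v4 (cruxes
stmt-BirchSwinnertonDyer-19945 / -19223); OFFER (N) of the seat = the lane's optional tail item (d) of planner D455.  After
Parts 32–36 the count side of stub 3 on the all-additive rows is the ONE display COUNT-X₀ («`KatoH2CountAt W p #(J₀.H2)_Γ` for every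
package `J₀ ⊇ (X₀)_γ` of finite cokernel», Kato (14.14.2) + (14.9.3) for the `X₀`-containing `𝐇²`-package).  On the TAME rows —
`W(ℚ_p)[p] = 0`, binder `h4 : ∀ R : (W.baseChange ℚ_[p]).toAffine.Point, p • R = 0 → R = 0` — two theorems of cell bsd-potss make it
computable: EXACT FINE CONTROL `ExactFineControl.katoH2CountAt_natCard_coinvariants_fineSelmerDual` (`KatoH2CountAt W p #(Y.X)_Γ` for
every dual fine Selmer datum `Y` of key `γ`, rank-free: `Sel_str(ℚ) ≅ Sel₀(ℚ_∞)^Γ`) and `TowerTorsionVanishing.fixedPoints_kerSubgroup_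
inf_decomp_eq_bot_of_noPTorsionPadic` (`W(ℚ_{p,∞})[p^∞] = 0`).  The link from `#(X₀)_Γ` to `#(J₀.H2)_Γ` is the print statement
H2X′ — H2X (`Kato2004.exists_iwasawaH2Data_fineSelmerDual_embedding`) SHARPENED: Kato's `𝐇²_Γ(T_pW)` contains `X₀` with cokernel
EMBEDDED INTO the Pontryagin dual of `W(ℚ_{p,∞})[p^∞]` (Poitou–Tate in the limit: (14.9.1) → (17.13.1) «`𝒳 → 𝐇²(T) → 𝐇²_loc(T)`»,
`𝐇²_loc ≅ Hom(H⁰(ℚ_p(ζ_{p^∞}), Hom(T, ℚ/ℤ)), ℚ/ℤ)(−1)` (display after (12.2.3)), read on the `Δ`-trivial component where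
`e₀𝐇²_loc = lim_n H²(ℚ_{p,n}, T_pW) ≅ (W(ℚ_{p,∞})[p^∞])^∨` by Tate local duality and the Weil pairing), DISPLAYED here as the
hypothesis `hH2X'` — H2X's text (same standing binders: `W/ℚ` elliptic, `p ≠ 2` — Kato's (17.13.1) is exact only up to `×2` at
`p = 2` —, `κ` cyclotomic with topological generator `γ`, `v` the place above `p`) with its finiteness hypothesis dropped and
`Finite (J.H2 ⧸ range e)` replaced by an injective additive `c : J.H2 ⧸ range e →+ CharacterModule (W(ℚ̄)[p^∞])^{ker κ ⊓ D_v}`; the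
target of `c` is the Pontryagin dual of the fixed points `W(ℚ̄)[p^∞]^{ker κ ⊓ D_v} = W(ℚ_{p,∞})[p^∞]`, `= e₀·𝐇²_loc(T_pW)` (twist) via
p. 220 + the Weil pairing [corpus: paper:doi-10-24033-ast-639 p105 L37–48 (= p. 220), p164 L27–63 (= p. 279)] (planner D554 source
check, R-N1/R-N2).  HONEST (R-N3): H2X′ is STRONGER than H2X (it implies H2X's conclusion whenever `W(ℚ_{p,∞})[p^∞]` is finite, §1);
a displayed hypothesis, not proved, not minted as a named fact here (cell bsd-potss's booked typer item, D455); 0 new debt.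
* §1 consequences of H2X′: `h2x_conclusion_of_h2x'` (H2X′ ∧ «`W(ℚ_{p,∞})[p^∞]` finite» ⟹ H2X's conclusion, by
  `PontryaginCard.finite_characterModule_of_finite`), `exists_bijective_of_h2x'` (H2X′ ∧ «`= ⊥`» ⟹ `∃ J e`, `e` BIJECTIVE).
* §2 **`countX₀_tame_of_gzk_of_thm12_4_of_h2x'`** — COUNT-X₀|tame (Part 34's COUNT-X₀ with `h4 →` in the slot of the all-additive
  clause) from {GZK, `thm12_4`, H2X′}: per row, `(J₁, e₁)` bijective over the pin (§1 + vanishing), `#(J₁.H2)_Γ = #((X₀)_γ)_Γ`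
  (`coinvariantsEquiv`), `#(J₀.H2)_Γ = #(J₁.H2)_Γ` for every `(J₀, e₀)` of finite cokernel (Part 34: the twin `J₁^ι` is (H2ᶜ)-pinned,
  J-matching, `ι`-insensitivity), and exact fine control.
* §3 **`rankOneCountReading_tame_of_facts (hGZK) (hlev) (h12) (hH2X') (hPRinv)`**: the body of `TorsionFree.RankOneCountReading
  IsKatoZetaDescentDatumOfContra Kato2004.PRRatio` with TWO binders inserted after `Finite W.sha →` — Part 32's all-additive clause and
  `h4` — from {GZK, lev, `thm12_4`, H2X′} + the display PR-INV ALONE (Part 35's master at `R W p :=` clause `∧ h4`); CM twin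
  `rankOneCountReading_cm_tame_of_facts` (`W.HasCM → h4 →`).
HONEST LABEL: theorems only; the registered v4 stub 3 is NOT closed; no recut performed; nothing is asserted on 19945 / 19223; H2X′,
`thm12_4`, GZK, lev are hypotheses; PR-INV is displayed, not proved; `h4` is a displayed row binder (tree theorems discharge it on the
𝒞₇ / additive `p ≥ 11` rows, not used here); Kato's Main Conjecture and Perrin-Riou's conjecture are not touched; BSD is not proved
for any curve.  References: [Kato2004Asterisque] §12.2 (12.2.3) (p. 220), Thm. 12.4 (p. 221), (14.9.1) (p. 239), (14.9.3) (p. 240),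
§14.14 (14.14.1)–(14.14.2) (p. 243), Lemma 14.15, Prop. 14.16 (p. 244), (17.13.1)–(17.13.4) (p. 279); [GreenbergLNM1716] §3 Lemma 3.1,
Lemma 3.2, Prop. 3.8; [Greenberg1989] §0 pp. 101–102; [SerreGaloisCohomology1997] II §5.2; [MilneADT2006] I Cor. 2.3.
-/

noncomputable section

open scoped Classical NumberField BigOperators ContRepresentation

open WeierstrassCurve Field IsDedekindDomain NumberField Rat.HeightOneSpectrum Literature.NumberTheory.EllipticCurves
  Literature.NumberTheory.EllipticCurves.ModularForms
  Literature.NumberTheory.EllipticCurves.Rank1Residual Literature.NumberTheory.EllipticCurves.Rank1Residual.Typed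
  Literature.NumberTheory.EllipticCurves.Kato2004 Literature.NumberTheory.EllipticCurves.IwasawaAlgebra
  Literature.NumberTheory.EllipticCurves.Kato2004.EulerSystemValues
  Literature.NumberTheory.GaloisRepresentations Literature.NumberTheory.GaloisRepresentations.DiscreteGaloisModule
open WeierstrassCurve (galH1Primary kummerMapTorsion)
open Summit.BirchSwinnertonDyer.BirchSwinnertonDyer.Theorems.CongruentShaFreeCutKatoDescentDatumOfH2
  Summit.BirchSwinnertonDyer.BirchSwinnertonDyer.Theorems.CongruentShaFreeCutKatoKummerLogTorsion
  Summit.BirchSwinnertonDyer.BirchSwinnertonDyer.Theorems.TowerTorsionVanishing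
  Summit.BirchSwinnertonDyer.BirchSwinnertonDyer.Theorems.ExactFineControl
open Summit.BirchSwinnertonDyer.Rank1Residual Summit.BirchSwinnertonDyer.Rank1Residual.Additive
  Summit.BirchSwinnertonDyer.Rank1Residual.Additive.ContraCount Summit.BirchSwinnertonDyer.Rank1Residual.Additive.LocPKummer
  Summit.BirchSwinnertonDyer.Rank1Residual.Additive.GlobalKummer

namespace Summit.BirchSwinnertonDyer.Rank1Residual.Additive.StrictCount

/-! ## §1 Consequences of the display H2X′ -/

section H2XPrime

/-- The character module of a trivial group is trivial. [folklore] -/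
theorem subsingleton_characterModule_of_subsingleton (A : Type*) [AddCommGroup A] [Subsingleton A] :
    Subsingleton (CharacterModule A) :=
  ⟨fun f g ↦ by ext a; rw [Subsingleton.elim a 0, map_zero, map_zero]⟩

variable {p : ℕ} [Fact p.Prime] {M N : Type*} [AddCommGroup M] [Module (IwasawaAlgebra p) M]
  [AddCommGroup N] [Module (IwasawaAlgebra p) N]

/-- A linear map whose cokernel embeds into a trivial group is surjective. [folklore] -/
theorem surjective_of_injective_quotient_of_subsingleton (e : M →ₗ[IwasawaAlgebra p] N) {C : Type*} [AddCommGroup C]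
    [Subsingleton C] (c : (N ⧸ LinearMap.range e) →+ C) (hc : Function.Injective c) : Function.Surjective e := by
  rw [← LinearMap.range_eq_top, ← Submodule.Quotient.subsingleton_iff]
  exact ⟨fun x y ↦ hc (Subsingleton.elim _ _)⟩

/-- A linear map whose cokernel embeds into a finite group has finite cokernel. [folklore] -/
theorem finite_quotient_of_injective_of_finite (e : M →ₗ[IwasawaAlgebra p] N) {C : Type*} [AddCommGroup C] [Finite C]
    (c : (N ⧸ LinearMap.range e) →+ C) (hc : Function.Injective c) : Finite (N ⧸ LinearMap.range e) :=
  Finite.of_injective c hc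

end H2XPrime

section H2XPrimeDisplays

/-- **H2X′ ⟹ H2X's conclusion under H2X's hypothesis** («`W(ℚ_{p,∞})[p^∞]` finite»): the character module of a finite group is
finite (`PontryaginCard.finite_characterModule_of_finite`), so a cokernel embedded in it is finite.  (The displayed H2X′ is
therefore at least as strong as the named fact `Kato2004.exists_iwasawaH2Data_fineSelmerDual_embedding`.)
[cite: Kato2004Asterisque, (14.9.1) (p. 239), §12.2 (12.2.3) (p. 220), (17.13.1) (p. 279)] [cite: MilneADT2006, Ch. I, Cor. 2.3] -/
theorem h2x_conclusion_of_h2x'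
    (hH2X' : ∀ (W : WeierstrassCurve ℚ) [W.IsElliptic] (p : ℕ) [Fact p.Prime] [ContinuousSMul ℤ_[p] (W.tateModule p)]
      (κ : ZpExtension ℚ p) (γ : absoluteGaloisGroup ℚ) (hγ : κ.IsTopGenerator γ) (v : HeightOneSpectrum (𝓞 ℚ)),
      p ≠ 2 → κ.IsCyclotomic → ((Rat.HeightOneSpectrum.primesEquiv v : Nat.Primes) : ℕ) = p →
      ∀ I : IwasawaH1Data W p κ γ,
        ∃ (J : IwasawaH2Data W p κ γ I) (e : (W.fineSelmerDualData κ hγ).X →ₗ[IwasawaAlgebra p] J.H2)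
          (c : (J.H2 ⧸ LinearMap.range e) →+
            CharacterModule ↥(FixedPoints.addSubgroup ↥(κ.kerSubgroup ⊓ GreenbergSelmer.decomp v) (W.geomPrimaryTorsion p))),
          Function.Injective e ∧ Function.Injective c) :
    exists_iwasawaH2Data_fineSelmerDual_embedding := by
  intro W _ p _ _ κ γ hγ v hp hκ hv hfin I
  obtain ⟨J, e, c, he, hc⟩ := hH2X' W p κ γ hγ v hp hκ hv I
  haveI := hfin
  haveI := PontryaginCard.finite_characterModule_of_finite
    (↥(FixedPoints.addSubgroup ↥(κ.kerSubgroup ⊓ GreenbergSelmer.decomp v) (W.geomPrimaryTorsion p)))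
  exact ⟨J, e, he, finite_quotient_of_injective_of_finite e c hc⟩

/-- **H2X′ ∧ `W(ℚ_{p,∞})[p^∞] = 0` ⟹ Kato's `𝐇²`-package IS `(X₀)_γ`**: over every pin there is a package `J` with a BIJECTIVE
`Λ`-linear `e : (W.fineSelmerDualData κ hγ).X → J.H2` (the cokernel embeds into the character module of the trivial group).  On the
tame rows (`W(ℚ_p)[p] = 0`) the vanishing is `TowerTorsionVanishing.fixedPoints_kerSubgroup_inf_decomp_eq_bot_of_noPTorsionPadic`.
[cite: Kato2004Asterisque, (14.9.1) (p. 239), §12.2 (12.2.3) (p. 220), (17.13.1)–(17.13.4) (p. 279)] [cite: GreenbergLNM1716, §3 Lemma 3.1] -/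
theorem exists_bijective_of_h2x'
    (hH2X' : ∀ (W : WeierstrassCurve ℚ) [W.IsElliptic] (p : ℕ) [Fact p.Prime] [ContinuousSMul ℤ_[p] (W.tateModule p)]
      (κ : ZpExtension ℚ p) (γ : absoluteGaloisGroup ℚ) (hγ : κ.IsTopGenerator γ) (v : HeightOneSpectrum (𝓞 ℚ)),
      p ≠ 2 → κ.IsCyclotomic → ((Rat.HeightOneSpectrum.primesEquiv v : Nat.Primes) : ℕ) = p →
      ∀ I : IwasawaH1Data W p κ γ,
        ∃ (J : IwasawaH2Data W p κ γ I) (e : (W.fineSelmerDualData κ hγ).X →ₗ[IwasawaAlgebra p] J.H2)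
          (c : (J.H2 ⧸ LinearMap.range e) →+
            CharacterModule ↥(FixedPoints.addSubgroup ↥(κ.kerSubgroup ⊓ GreenbergSelmer.decomp v) (W.geomPrimaryTorsion p))),
          Function.Injective e ∧ Function.Injective c)
    {W : WeierstrassCurve ℚ} [W.IsElliptic] {p : ℕ} [Fact p.Prime] [ContinuousSMul ℤ_[p] (W.tateModule p)]
    {κ : ZpExtension ℚ p} {γ : absoluteGaloisGroup ℚ} (hγ : κ.IsTopGenerator γ) (v : HeightOneSpectrum (𝓞 ℚ))
    (hp : p ≠ 2) (hκ : κ.IsCyclotomic) (hv : ((Rat.HeightOneSpectrum.primesEquiv v : Nat.Primes) : ℕ) = p)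
    (hbot : FixedPoints.addSubgroup ↥(κ.kerSubgroup ⊓ GreenbergSelmer.decomp v) (W.geomPrimaryTorsion p) = ⊥)
    (I : IwasawaH1Data W p κ γ) :
    ∃ (J : IwasawaH2Data W p κ γ I) (e : (W.fineSelmerDualData κ hγ).X →ₗ[IwasawaAlgebra p] J.H2), Function.Bijective e := by
  obtain ⟨J, e, c, he, hc⟩ := hH2X' W p κ γ hγ v hp hκ hv I
  haveI : Subsingleton ↥(FixedPoints.addSubgroup ↥(κ.kerSubgroup ⊓ GreenbergSelmer.decomp v) (W.geomPrimaryTorsion p)) := by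
    rw [hbot]; infer_instance
  haveI := subsingleton_characterModule_of_subsingleton
    (↥(FixedPoints.addSubgroup ↥(κ.kerSubgroup ⊓ GreenbergSelmer.decomp v) (W.geomPrimaryTorsion p)))
  exact ⟨J, e, he, surjective_of_injective_quotient_of_subsingleton e c hc⟩

end H2XPrimeDisplays

/-! ## §2 COUNT-X₀ on the tame rows from {GZK, `thm12_4`, H2X′} -/

section CountTame

/-- **COUNT-X₀|tame ⟸ {GZK, `Kato2004.thm12_4`, H2X′}.**  The conclusion is Part 34's display COUNT-X₀ with the tame binder
`(∀ R : (W.baseChange ℚ_[p]).toAffine.Point, p • R = 0 → R = 0) →` in the slot of the all-additive clause.  Per row: GZK ⟹ rank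
one and `thm12_4` ⟹ `(·)_Γ` finite on every package over the pin; `W(ℚ_{p,∞})[p^∞] = 0` (TowerTorsionVanishing) and H2X′ give
`(J₁, e₁)` with `e₁ : (X₀)_γ ⥲ J₁.H2`, so `#(J₁.H2)_Γ = #((X₀)_γ)_Γ` (`coinvariantsEquiv`); for the given `(J₀, e₀)` of finite cokernel,
`#(J₀.H2)_Γ = #(J₁^ι.H2)_Γ = #(J₁.H2)_Γ` (Part 34: `J₁^ι` is (H2ᶜ)-pinned, J-matching, `ι`-insensitivity); and EXACT FINE CONTROL
gives `KatoH2CountAt W p #((X₀)_γ)_Γ`. [cite: Kato2004Asterisque, Thm. 12.4 (p. 221), (14.9.1) (p. 239), (14.9.3) (p. 240), §14.14 (14.14.1)–(14.14.2) (p. 243), Lemma 14.15 (p. 244), (17.13.1) (p. 279)]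
[cite: GreenbergLNM1716, §3 Lemma 3.1, Lemma 3.2 and Prop. 3.8] [cite: Greenberg1989, §0 pp. 101–102] -/
theorem countX₀_tame_of_gzk_of_thm12_4_of_h2x' (hGZK : rank_eq_analyticRank_of_analyticRank_le_one)
    (h12 : Kato2004.thm12_4)
    (hH2X' : ∀ (W : WeierstrassCurve ℚ) [W.IsElliptic] (p : ℕ) [Fact p.Prime] [ContinuousSMul ℤ_[p] (W.tateModule p)]
      (κ : ZpExtension ℚ p) (γ : absoluteGaloisGroup ℚ) (hγ : κ.IsTopGenerator γ) (v : HeightOneSpectrum (𝓞 ℚ)),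
      p ≠ 2 → κ.IsCyclotomic → ((Rat.HeightOneSpectrum.primesEquiv v : Nat.Primes) : ℕ) = p →
      ∀ I : IwasawaH1Data W p κ γ,
        ∃ (J : IwasawaH2Data W p κ γ I) (e : (W.fineSelmerDualData κ hγ).X →ₗ[IwasawaAlgebra p] J.H2)
          (c : (J.H2 ⧸ LinearMap.range e) →+
            CharacterModule ↥(FixedPoints.addSubgroup ↥(κ.kerSubgroup ⊓ GreenbergSelmer.decomp v) (W.geomPrimaryTorsion p))),
          Function.Injective e ∧ Function.Injective c) :
    ∀ (W : WeierstrassCurve ℚ) [W.IsElliptic] [W.IsGloballyMinimal] (p : ℕ) [Fact p.Prime],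
      letI : ContinuousSMul ℤ_[p] (W.tateModule p) := TateModule.continuousSMul_padicInt
      ∀ (κ : ZpExtension ℚ p) (γ : absoluteGaloisGroup ℚ), κ.IsCyclotomic → (hγ : κ.IsTopGenerator γ) →
        ∀ (I : IwasawaH1Data W p κ γ) (J₀ : IwasawaH2Data W p κ γ I)
          (e₀ : (W.fineSelmerDualData κ hγ).X →ₗ[IwasawaAlgebra p] J₀.H2),
          W.analyticRank = 1 → p ≠ 2 → Addv W p → 0 ≤ padicValRat p W.j → ¬ p ∣ W.torsionOrder → Finite W.sha →
          (∀ R : (W.baseChange ℚ_[p]).toAffine.Point, p • R = 0 → R = 0) →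
          Function.Injective e₀ → Finite (J₀.H2 ⧸ LinearMap.range e₀) →
          KatoH2CountAt W p (Nat.card (coinvariants p J₀.H2)) := by
  intro W _ _ p _
  letI : ContinuousSMul ℤ_[p] (W.tateModule p) := TateModule.continuousSMul_padicInt
  intro κ γ hκ hγ I J₀ e₀ hr hp2 hadd hj htors hsha h4 he₀ hfin₀
  obtain ⟨hmw, -⟩ := hGZK W (by rw [hr])
  have hrank : W.mordellWeilRank = 1 := by rw [hmw, hr]
  haveI := hsha
  have hsha' : Finite (AddCommGroup.primaryComponent W.sha p) := inferInstance
  obtain ⟨hfg, ⟨htf, hrk⟩, -⟩ := h12 W p κ γ hκ hγ I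
  haveI := hfg
  haveI := htf
  haveI : Nontrivial I.H := by
    by_contra hnt
    rw [not_nontrivial_iff_subsingleton] at hnt
    have h0 : Module.rank (IwasawaAlgebra p) I.H = 0 := rank_subsingleton' _ _
    rw [hrk] at h0
    exact one_ne_zero h0
  -- the bijective package over THIS pin: H2X′ + `W(ℚ_{p,∞})[p^∞] = 0`
  have hbot := fixedPoints_kerSubgroup_inf_decomp_eq_bot_of_noPTorsionPadic W p κ (primePlace p)
    (coe_primesEquiv_primePlace p) h4
  obtain ⟨J₁, e₁, hbij⟩ := exists_bijective_of_h2x' hH2X' hγ (primePlace p) hp2 hκ (coe_primesEquiv_primePlace p) hbot I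
  haveI : Finite (coinvariants p J₀.H2) := finite_coinvariants_H2_of_iwasawaH2Data W p J₀ hrank hsha'
  haveI hJ₁ : Finite (coinvariants p J₁.H2) := finite_coinvariants_H2_of_iwasawaH2Data W p J₁ hrank hsha'
  -- `#(J₁.H2)_Γ = #((X₀)_γ)_Γ`
  have hX₀ : Nat.card (coinvariants p (W.fineSelmerDualData κ hγ).X) = Nat.card (coinvariants p J₁.H2) :=
    Nat.card_congr (coinvariantsEquiv (LinearEquiv.ofBijective e₁ hbij)).toEquiv
  -- `#(J₀.H2)_Γ = #(J₁.H2)_Γ`: the twin `J₁^ι` is (H2ᶜ)-pinned; J-matching with `(J₀, e₀)`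
  have hfin₁ : Finite (J₁.H2 ⧸ LinearMap.range e₁) := by
    rw [LinearMap.range_eq_top.mpr hbij.2]
    infer_instance
  obtain ⟨J', e', he', hpin'⟩ := exists_involTwist_pinned_contra_of_embedding W p hγ J₁ e₁ hbij.1 hfin₁
  haveI : Finite (coinvariants p J'.H2) := finite_coinvariants_of_involSemilinear e' he'
  have hmatch := natCard_coinvariants_H2_eq_of_pinned_of_embedding W p hγ J' hpin' J₀ e₀ he₀ hfin₀
  rw [natCard_coinvariants_eq_of_involSemilinear e' he'] at hmatch
  -- exact fine control: `KatoH2CountAt W p #((X₀)_γ)_Γ`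
  have hcount := katoH2CountAt_natCard_coinvariants_fineSelmerDual W κ hp2 hκ hγ h4 (W.fineSelmerDualData κ hγ)
  rw [hX₀, hmatch] at hcount
  exact hcount

end CountTame

/-! ## §3 The recut stub 3 on the tame all-additive / CM rows from {GZK, lev, `thm12_4`, H2X′} + PR-INV alone -/

section Tame

/-- **STUB 3 ON THE TAME ALL-ADDITIVE ROWS from {GZK, `IsNewformOf.level_eq_conductorNorm`, `Kato2004.thm12_4`, H2X′} + PR-INV.**
The conclusion is the body of `TorsionFree.RankOneCountReading IsKatoZetaDescentDatumOfContra Kato2004.PRRatio`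
(`KatoDescentTorsionFreeReadings.lean` l.152–161) with TWO binders inserted after `Finite W.sha →`: Part 32's all-additive clause
and the tame binder `(∀ R : (W.baseChange ℚ_[p]).toAffine.Point, p • R = 0 → R = 0) →`.  NO count display remains: COUNT-X₀|tame is
§2.  (Part 35's master at `R W p :=` clause `∧` tame.)  CONDITIONAL; the registered v4 stub is NOT closed; no recut performed.
[cite: Kato2004Asterisque, Thm. 12.4 (p. 221), §13.9 (p. 230), (14.9.1) (p. 239), (14.9.3) (p. 240), §14.14 (14.14.1)–(14.14.2) (p. 243), Prop. 14.16 (p. 244), (17.13.1) (p. 279)]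
[cite: BurnsKuriharaSano2019, Thm. 7.3 (p. 29) and Thm. 7.8 (d) (p. 30)] [cite: GrossZagier1986, Thm. I.7.3] [cite: GreenbergLNM1716, §3 Prop. 3.8] -/
theorem rankOneCountReading_tame_of_facts
    (hGZK : rank_eq_analyticRank_of_analyticRank_le_one)
    (hlev : ∀ (N : ℕ) [NeZero N], IsNewformOf.level_eq_conductorNorm (N := N))
    (h12 : Kato2004.thm12_4)
    (hH2X' : ∀ (W : WeierstrassCurve ℚ) [W.IsElliptic] (p : ℕ) [Fact p.Prime] [ContinuousSMul ℤ_[p] (W.tateModule p)]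
      (κ : ZpExtension ℚ p) (γ : absoluteGaloisGroup ℚ) (hγ : κ.IsTopGenerator γ) (v : HeightOneSpectrum (𝓞 ℚ)),
      p ≠ 2 → κ.IsCyclotomic → ((Rat.HeightOneSpectrum.primesEquiv v : Nat.Primes) : ℕ) = p →
      ∀ I : IwasawaH1Data W p κ γ,
        ∃ (J : IwasawaH2Data W p κ γ I) (e : (W.fineSelmerDualData κ hγ).X →ₗ[IwasawaAlgebra p] J.H2)
          (c : (J.H2 ⧸ LinearMap.range e) →+
            CharacterModule ↥(FixedPoints.addSubgroup ↥(κ.kerSubgroup ⊓ GreenbergSelmer.decomp v) (W.geomPrimaryTorsion p))),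
          Function.Injective e ∧ Function.Injective c)
    (hPRinv : ∀ (W : WeierstrassCurve ℚ) [W.IsElliptic] [W.IsGloballyMinimal] (p : ℕ) [Fact p.Prime]
      (ℒ₁ ℒ₂ : ℚ_[p]), Kato2004.PRRatio W p ℒ₁ → Kato2004.PRRatio W p ℒ₂ → ∃ w : ℚ_[p], ‖w‖ = 1 ∧ ℒ₂ = w * ℒ₁) :
    ∀ (W : WeierstrassCurve ℚ) [W.IsElliptic] [W.IsGloballyMinimal] (p : ℕ) [Fact p.Prime]
      (D : KatoDescentDatum p) (ℒ : ℚ_[p]),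
      W.analyticRank = 1 → p ≠ 2 → Addv W p → 0 ≤ padicValRat p W.j → ¬ p ∣ W.torsionOrder →
      Finite W.sha →
      (∀ v ∈ W.badPlaces (𝓞 ℚ), ((Rat.HeightOneSpectrum.primesEquiv v : Nat.Primes) : ℕ) ≠ p →
        W.HasAdditiveReductionAt v) →
      (∀ R : (W.baseChange ℚ_[p]).toAffine.Point, p • R = 0 → R = 0) →
      IsKatoZetaDescentDatumOfContra W p D → Kato2004.PRRatio W p ℒ →
      Finite (coinvariants p D.H2) ∧ (ℒ ≠ 0 ↔ D.zetaIndex ≠ 0) ∧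
        ∀ m : ℕ, D.zetaIndex = p ^ m * D.h2Card →
          ℒ.valuation = (m : ℤ) +
            padicValNat p (Nat.card (AddCommGroup.primaryComponent W.sha p)) +
            padicValNat p W.tamagawaProduct := by
  intro W _ _ p _ D ℒ hr hp2 hadd hj htors hsha hall h4 hD hℒ
  refine rankOneCountReading_of_facts_of_rowPred
    (fun W p ↦ (∀ v ∈ W.badPlaces (𝓞 ℚ), ((Rat.HeightOneSpectrum.primesEquiv v : Nat.Primes) : ℕ) ≠ p →
      W.HasAdditiveReductionAt v) ∧ ∀ hp : p.Prime, haveI : Fact p.Prime := ⟨hp⟩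
      ∀ R : (W.baseChange ℚ_[p]).toAffine.Point, p • R = 0 → R = 0)
    (fun _ _ _ _ _ h ↦ h.1) hGZK hlev h12 (h2x_conclusion_of_h2x' hH2X') hPRinv ?_ W p D ℒ hr hp2 hadd hj htors hsha
    ⟨hall, fun _ ↦ h4⟩ hD hℒ
  intro W _ _ p _
  letI : ContinuousSMul ℤ_[p] (W.tateModule p) := TateModule.continuousSMul_padicInt
  intro κ γ hκ hγ I J₀ e₀ hr hp2 hadd hj htors hsha hR he₀ hfin₀
  exact countX₀_tame_of_gzk_of_thm12_4_of_h2x' hGZK h12 hH2X' W p κ γ hκ hγ I J₀ e₀ hr hp2 hadd hj htors hsha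
    (hR.2 Fact.out) he₀ hfin₀

/-- **STUB 3 ON THE TAME CM ROWS from {GZK, `IsNewformOf.level_eq_conductorNorm`, `Kato2004.thm12_4`, H2X′} + PR-INV** — the body with
`W.HasCM →` and the tame binder inserted after `Finite W.sha →` (the binders of `X12.CMInertBad`'s rows at a tame `p`; every 𝒞₇ curve
has CM and is tame at `7`).  (Part 35's master at `R W p := W.HasCM ∧` tame, all-additive by Part 33 §1.)  CONDITIONAL; the registered
v4 stub is NOT closed; no recut performed. [cite: Kato2004Asterisque, Thm. 12.4 (p. 221), (14.9.3) (p. 240), §14.14 (p. 243), Prop. 14.16 (p. 244), (17.13.1) (p. 279)]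
[cite: SilvermanATAEC1994, proof of Thm. II.10.5 (p. 172)] [cite: GrossZagier1986, Thm. I.7.3] -/
theorem rankOneCountReading_cm_tame_of_facts
    (hGZK : rank_eq_analyticRank_of_analyticRank_le_one)
    (hlev : ∀ (N : ℕ) [NeZero N], IsNewformOf.level_eq_conductorNorm (N := N))
    (h12 : Kato2004.thm12_4)
    (hH2X' : ∀ (W : WeierstrassCurve ℚ) [W.IsElliptic] (p : ℕ) [Fact p.Prime] [ContinuousSMul ℤ_[p] (W.tateModule p)]
      (κ : ZpExtension ℚ p) (γ : absoluteGaloisGroup ℚ) (hγ : κ.IsTopGenerator γ) (v : HeightOneSpectrum (𝓞 ℚ)),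
      p ≠ 2 → κ.IsCyclotomic → ((Rat.HeightOneSpectrum.primesEquiv v : Nat.Primes) : ℕ) = p →
      ∀ I : IwasawaH1Data W p κ γ,
        ∃ (J : IwasawaH2Data W p κ γ I) (e : (W.fineSelmerDualData κ hγ).X →ₗ[IwasawaAlgebra p] J.H2)
          (c : (J.H2 ⧸ LinearMap.range e) →+
            CharacterModule ↥(FixedPoints.addSubgroup ↥(κ.kerSubgroup ⊓ GreenbergSelmer.decomp v) (W.geomPrimaryTorsion p))),
          Function.Injective e ∧ Function.Injective c)
    (hPRinv : ∀ (W : WeierstrassCurve ℚ) [W.IsElliptic] [W.IsGloballyMinimal] (p : ℕ) [Fact p.Prime]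
      (ℒ₁ ℒ₂ : ℚ_[p]), Kato2004.PRRatio W p ℒ₁ → Kato2004.PRRatio W p ℒ₂ → ∃ w : ℚ_[p], ‖w‖ = 1 ∧ ℒ₂ = w * ℒ₁) :
    ∀ (W : WeierstrassCurve ℚ) [W.IsElliptic] [W.IsGloballyMinimal] (p : ℕ) [Fact p.Prime]
      (D : KatoDescentDatum p) (ℒ : ℚ_[p]),
      W.analyticRank = 1 → p ≠ 2 → Addv W p → 0 ≤ padicValRat p W.j → ¬ p ∣ W.torsionOrder →
      Finite W.sha →
      W.HasCM →
      (∀ R : (W.baseChange ℚ_[p]).toAffine.Point, p • R = 0 → R = 0) →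
      IsKatoZetaDescentDatumOfContra W p D → Kato2004.PRRatio W p ℒ →
      Finite (coinvariants p D.H2) ∧ (ℒ ≠ 0 ↔ D.zetaIndex ≠ 0) ∧
        ∀ m : ℕ, D.zetaIndex = p ^ m * D.h2Card →
          ℒ.valuation = (m : ℤ) +
            padicValNat p (Nat.card (AddCommGroup.primaryComponent W.sha p)) +
            padicValNat p W.tamagawaProduct := by
  intro W _ _ p _ D ℒ hr hp2 hadd hj htors hsha hCM h4 hD hℒ
  refine rankOneCountReading_of_facts_of_rowPred
    (fun W p ↦ W.HasCM ∧ ∀ hp : p.Prime, haveI : Fact p.Prime := ⟨hp⟩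
      ∀ R : (W.baseChange ℚ_[p]).toAffine.Point, p • R = 0 → R = 0)
    (fun W _ _ p _ h ↦ forall_badPlaces_hasAdditiveReductionAt_of_hasCM W p h.1) hGZK hlev h12 (h2x_conclusion_of_h2x' hH2X')
    hPRinv ?_ W p D ℒ hr hp2 hadd hj htors hsha ⟨hCM, fun _ ↦ h4⟩ hD hℒ
  intro W _ _ p _
  letI : ContinuousSMul ℤ_[p] (W.tateModule p) := TateModule.continuousSMul_padicInt
  intro κ γ hκ hγ I J₀ e₀ hr hp2 hadd hj htors hsha hR he₀ hfin₀
  exact countX₀_tame_of_gzk_of_thm12_4_of_h2x' hGZK h12 hH2X' W p κ γ hκ hγ I J₀ e₀ hr hp2 hadd hj htors hsha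
    (hR.2 Fact.out) he₀ hfin₀

end Tame

end Summit.BirchSwinnertonDyer.Rank1Residual.Additive.StrictCount

end
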